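import Summits.QuantumFields.YangMills.Theorems.LangevinControlUVFemtoCurvatureTwoPointCTorusCombGauge
import Summits.QuantumFields.YangMills.Theorems.LangevinControlUVFemtoCurvatureTwoPointCSkewHaar
import Summits.QuantumFields.YangMills.Theorems.LangevinControlUVFemtoCurvatureTwoPointStubDoublingOfRV
import HarnessLib

/-!
# Route `LangevinControlUV`, crux `FemtoCurvatureTwoPointC` (stmt-QuantumFields-16204), line `birth` —
# the gauge-fixed Gaussian LOWER bound of the torus free-energy sandwich

Registered wave-4 sub-goal `torusPartitionFunction_lower` (`--supports stmt-QuantumFields-16204`),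
proved verbatim: for a compact second-countable group `G` with a faithful continuous unitary
lattice representation `r` (`D = dimE r.ρ`, the dimension of `G` read in the exponential chart)
there are `C₁ > 0` and `A` such that on every torus `(ℤ/L)⁴` and for every `β ≥ 1`

  `e^{−A L⁴} · (C₁ β^{−D/2})^{3L⁴+1} ≤ Z_L(β)`,

`Z_L(β) = ∫ e^{−β S} dHaar^{⊗E}` the Wilson partition function (`partitionFunction`).

**Why.** The crude Gaussian lower bound of `FemtoCurvatureTwoPoint.DoublingOfRV`
(`exp_mul_pow_le_partitionFunction_toReal`: restrict ALL `#E = 4L⁴` links to the ball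
`‖r(U_e) − 1‖ ≤ β^{−1/2}`) decays like `β^{−(D/2)·4L⁴} = β^{−2DL⁴}`, whereas the true order of `Z_L`
at `β → ∞` is `β^{−(D/2)(#E − #V + 1)} = β^{−(D/2)(3L⁴+1)}`: the `L⁴ − 1` links of a spanning tree
are pure gauge. Here we first fix the **comb-tree gauge** (`TorusCombGauge`): gauging `U` by its comb
holonomies `H(U, ·)` kills the `L⁴ − 1` comb links (`gaugeTransform_combHolonomy_of_mem`), and off
the comb the gauged links `H(U,x) U(x,μ) H(U,x+e_μ)⁻¹` are two-sided translates of `U(x,μ)` by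
elements reading only comb links, so their joint law under product Haar is product Haar on
`G^{combᶜ}` (`map_pi_haar_twoSided_eq` of `SkewHaar`; here `map_combSection_pi_haar`). By gauge
invariance of the action this gives the **comb-gauge reduction**

  `Z_L(β) = ∫_{G^{combᶜ}} e^{−β S(ext W)} dW`   (`partitionFunction_eq_lintegral_combGauge`),

`ext W` the extension of `W` by `1` on the comb, and restricting the `3L⁴ + 1` off-comb links to the
ball of radius `δ = β^{−1/2}` (where `S ≤ 8 δ² #P = 48 L⁴ / β`, `wilsonAction_le_of_ball`, and the
ball has Haar mass `≥ C₁ δ^D`, `exists_haar_gball_ge`) yields the bound with `A = 48` and the sharp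
exponent `(D/2)(3L⁴+1)` instead of the crude `2 D L⁴` (`exp_mul_pow_le_partitionFunction_toReal_comb`,
master form in `δ`). Together with the triangular UPPER bound of the sandwich (same polynomial order
`β^{−(D/2)(3L⁴+1)}` up to factors `e^{O(L⁴)}`) it gives the uniform doubling
`Z_L(β/2) ≤ e^{A' L⁴} Z_L(β)` in the regime `log β ≲ L`, which feeds the crux's variance-ceiling
stub V.

Everything is proved from Mathlib and landed tree files; no named facts, no new definitions (the
gauge-fixing map `U ↦ (H(U,x) U(x,μ) H(U,x+e_μ)⁻¹)_{(x,μ) ∉ comb}` and the extension by `1` are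
written as explicit lambdas).
-/

set_option autoImplicit false

noncomputable section

open scoped Matrix.Norms.Frobenius ENNReal
open MeasureTheory
open Literature.MathematicalPhysics.QuantumFieldTheory
open Summit.QuantumFields.YangMills.Theorems.FreeEnergyLogCoefficient (dimE exists_haar_gball_ge
  measurableSet_gball)
open Summit.QuantumFields.YangMills.Theorems.FemtoCurvatureTwoPoint.DoublingOfRV (wilsonAction_le_of_ball
  card_plaquette)

namespace Summit.QuantumFields.YangMills.Theorems.FemtoCurvatureTwoPointC.TorusGauge

/-! ### The comb gauge, pointwise -/

section Algebra

variable {L : ℕ} [NeZero L] {G : Type*} [Group G]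

/-- **The comb gauge of `U`, as the extension by `1` of its off-comb links**: the configuration
equal to `1` on the comb and to `H(U,x) U(x,μ) H(U,x+e_μ)⁻¹` on an off-comb edge `(x, μ)` is
`U^{H(U)}` (comb links are killed, `gaugeTransform_combHolonomy_of_mem`), hence has the Wilson action
of `U` (`wilsonAction_gaugeTransform`). -/
theorem wilsonAction_combGauge {N : ℕ} (ρ : G →* Matrix (Fin N) (Fin N) ℂ) (U : GaugeConfig 4 L G) :
    wilsonAction ρ (fun e : Edge 4 L => if _ : e ∈ combEdges L then (1 : G) else
        combHolonomy U e.1 * U e * (combHolonomy U (e.1.shift e.2))⁻¹) = wilsonAction ρ U := by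
  have hfun : (fun e : Edge 4 L => if _ : e ∈ combEdges L then (1 : G) else
      combHolonomy U e.1 * U e * (combHolonomy U (e.1.shift e.2))⁻¹) =
      gaugeTransform (combHolonomy U) U := by
    funext e
    by_cases he : e ∈ combEdges L
    · rw [dif_pos he, gaugeTransform_combHolonomy_of_mem U he]
    · rw [dif_neg he]
      rfl
  rw [hfun, wilsonAction_gaugeTransform]

/-- **Small gauge-fixed links force a small action**: if every OFF-comb link of the comb gauge
`U^{H(U)}` is `δ`-close to `1` through the unitary `ρ` (`δ ≥ 0`), then `S(U) ≤ 8 δ² #P` — the comb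
links of `U^{H(U)}` are exactly `1`, so all its links are `δ`-close to `1` (`wilsonAction_le_of_ball`),
and `S(U) = S(U^{H(U)})`. -/
theorem wilsonAction_le_of_comb_ball {N : ℕ} (ρ : G →* Matrix (Fin N) (Fin N) ℂ)
    (hU : ∀ g, ρ g ∈ Matrix.unitaryGroup (Fin N) ℂ) {U : GaugeConfig 4 L G} {δ : ℝ} (hδ : 0 ≤ δ)
    (hUδ : ∀ e : Edge 4 L, e ∉ combEdges L →
      ‖ρ (combHolonomy U e.1 * U e * (combHolonomy U (e.1.shift e.2))⁻¹) - 1‖ ≤ δ) :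
    wilsonAction ρ U ≤ 8 * δ ^ 2 * Fintype.card (Plaquette 4 L) := by
  rw [← wilsonAction_gaugeTransform ρ (combHolonomy U) U]
  refine wilsonAction_le_of_ball ρ hU fun e => ?_
  by_cases he : e ∈ combEdges L
  · rw [gaugeTransform_combHolonomy_of_mem U he, map_one, sub_self, norm_zero]
    exact hδ
  · exact hUδ e he

/-- **The off-comb edges number `3 L⁴ + 1`** (`card_compl_combEdges`). -/
theorem card_offComb (L : ℕ) [NeZero L] :
    Fintype.card {e : Edge 4 L // e ∉ combEdges L} = 3 * L ^ 4 + 1 := by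
  rw [Fintype.card_of_subtype (combEdges L)ᶜ fun e => Finset.mem_compl, card_compl_combEdges]

/-- The extension by `1` on the comb, `W ↦ ext W`, is measurable (each coordinate is constant or a
coordinate projection). -/
theorem measurable_combExtend [MeasurableSpace G] :
    Measurable fun (W : {e : Edge 4 L // e ∉ combEdges L} → G) (e : Edge 4 L) =>
      if h : e ∈ combEdges L then (1 : G) else W ⟨e, h⟩ := by
  refine measurable_pi_lambda _ fun e => ?_
  by_cases he : e ∈ combEdges L
  · simp only [dif_pos he]
    exact measurable_const
  · simp only [dif_neg he]
    exact measurable_pi_apply _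

end Algebra

/-! ### The law of the gauge-fixed links and the comb-gauge reduction of `Z_L` -/

section Measure

variable {L : ℕ} [NeZero L] {G : Type} [Group G] [TopologicalSpace G] [IsTopologicalGroup G]
  [CompactSpace G] [MeasurableSpace G] [BorelSpace G] [SecondCountableTopology G]

omit [CompactSpace G] in
/-- The gauge-fixing map `U ↦ (H(U,x) U(x,μ) H(U,x+e_μ)⁻¹)_{(x,μ) ∉ comb}` is measurable (comb
holonomies are finite ordered products of coordinates, `measurable_combHolonomy`). -/
theorem measurable_combSection :
    Measurable fun (U : GaugeConfig 4 L G) (e : {e : Edge 4 L // e ∉ combEdges L}) =>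
      combHolonomy U e.1.1 * U e.1 * (combHolonomy U (e.1.1.shift e.1.2))⁻¹ := by
  refine measurable_pi_lambda _ fun e => ?_
  exact ((measurable_combHolonomy e.1.1).mul (measurable_pi_apply e.1)).mul
    (measurable_combHolonomy _).inv

/-- **The law of the gauge-fixed off-comb links under product Haar is product Haar** on
`G^{combᶜ}`: the gauge-fixing map multiplies each off-comb coordinate on both sides by elements
depending (measurably) on the comb coordinates only (`combHolonomy_congr`), so the skew product Haar
lemma `map_pi_haar_twoSided_eq` applies. -/
theorem map_combSection_pi_haar :
    (Measure.pi fun _ : Edge 4 L => haarProbability G).map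
        (fun (U : GaugeConfig 4 L G) (e : {e : Edge 4 L // e ∉ combEdges L}) =>
          combHolonomy U e.1.1 * U e.1 * (combHolonomy U (e.1.1.shift e.1.2))⁻¹) =
      Measure.pi fun _ : {e : Edge 4 L // e ∉ combEdges L} => haarProbability G :=
  map_pi_haar_twoSided_eq (combEdges L) (fun U e => combHolonomy U e.1)
    (fun U e => (combHolonomy U (e.1.shift e.2))⁻¹) (fun e => measurable_combHolonomy e.1)
    (fun e => (measurable_combHolonomy (e.1.shift e.2)).inv)
    (fun _ _ h => funext fun e => combHolonomy_congr h e.1)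
    (fun _ _ h => funext fun e => congrArg Inv.inv (combHolonomy_congr h (e.1.shift e.2)))

/-- **Comb-gauge reduction of the torus partition function**: for a continuous representation `ρ`,
`Z_L(β) = ∫_{G^{combᶜ}} e^{−β S(ext W)} dHaar^{⊗ combᶜ}(W)`, `ext W` the extension of `W` by `1` on the
comb — the `L⁴ − 1` comb links are pure gauge and integrate out (gauge invariance
`wilsonAction_combGauge` and the law `map_combSection_pi_haar`). -/
theorem partitionFunction_eq_lintegral_combGauge {N : ℕ} (ρ : G →* Matrix (Fin N) (Fin N) ℂ)
    (hρ : Continuous ρ) (β : ℝ) :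
    partitionFunction (d := 4) (L := L) ρ β =
      ∫⁻ W, ENNReal.ofReal (Real.exp (-β * wilsonAction ρ
          (fun e : Edge 4 L => if h : e ∈ combEdges L then (1 : G) else W ⟨e, h⟩)))
        ∂(Measure.pi fun _ : {e : Edge 4 L // e ∉ combEdges L} => haarProbability G) := by
  have hF : Measurable fun W : {e : Edge 4 L // e ∉ combEdges L} → G =>
      ENNReal.ofReal (Real.exp (-β * wilsonAction ρ
        (fun e : Edge 4 L => if h : e ∈ combEdges L then (1 : G) else W ⟨e, h⟩))) :=
    ENNReal.measurable_ofReal.comp (Real.measurable_exp.comp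
      (((WilsonRP.measurable_wilsonAction ρ hρ).comp measurable_combExtend).const_mul _))
  calc partitionFunction (d := 4) (L := L) ρ β
      = ∫⁻ U, ENNReal.ofReal (Real.exp (-β * wilsonAction ρ U))
          ∂(Measure.pi fun _ : Edge 4 L => haarProbability G) := by
        simp only [partitionFunction, wilsonWeight, withDensity_apply _ MeasurableSet.univ,
          Measure.restrict_univ]
    _ = ∫⁻ U, ENNReal.ofReal (Real.exp (-β * wilsonAction ρ
          (fun e : Edge 4 L => if _ : e ∈ combEdges L then (1 : G) else
            combHolonomy U e.1 * U e * (combHolonomy U (e.1.shift e.2))⁻¹)))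
          ∂(Measure.pi fun _ : Edge 4 L => haarProbability G) := by
        simp only [wilsonAction_combGauge]
    _ = ∫⁻ W, ENNReal.ofReal (Real.exp (-β * wilsonAction ρ
          (fun e : Edge 4 L => if h : e ∈ combEdges L then (1 : G) else W ⟨e, h⟩)))
        ∂((Measure.pi fun _ : Edge 4 L => haarProbability G).map
          (fun (U : GaugeConfig 4 L G) (e : {e : Edge 4 L // e ∉ combEdges L}) =>
            combHolonomy U e.1.1 * U e.1 * (combHolonomy U (e.1.1.shift e.1.2))⁻¹)) :=
        (lintegral_map hF measurable_combSection).symm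
    _ = _ := by rw [map_combSection_pi_haar]

omit [SecondCountableTopology G] in
/-- Product-Haar mass of the off-comb product ball:
`Haar^{⊗ combᶜ}{∀ e, ‖ρ(W_e) − 1‖ ≤ δ} = Haar{‖ρ g − 1‖ ≤ δ}^{3L⁴+1}`. -/
theorem pi_offComb_ball_eq {N : ℕ} (ρ : G →* Matrix (Fin N) (Fin N) ℂ) (L : ℕ) [NeZero L] (δ : ℝ) :
    Measure.pi (fun _ : {e : Edge 4 L // e ∉ combEdges L} => haarProbability G)
        (Set.pi Set.univ fun _ => {g : G | ‖ρ g - 1‖ ≤ δ}) =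
      (haarProbability G {g : G | ‖ρ g - 1‖ ≤ δ}) ^ (3 * L ^ 4 + 1) := by
  rw [Measure.pi_pi, Finset.prod_const, Finset.card_univ, card_offComb]

/-- **The sublevel set `{S ≤ 8 δ² #P}` is at least as heavy as the off-comb product ball**
(`δ ≥ 0`, `ρ` continuous and unitary): the preimage of the ball
`{W | ∀ e ∉ comb, ‖ρ(W_e) − 1‖ ≤ δ}` under the gauge-fixing map lies in the sublevel set
(`wilsonAction_le_of_comb_ball`), and its product-Haar mass is that of the ball
(`map_combSection_pi_haar`). -/
theorem pi_offComb_ball_le_pi_wilsonAction_le {N : ℕ} (ρ : G →* Matrix (Fin N) (Fin N) ℂ)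
    (hρ : Continuous ρ) (hU : ∀ g, ρ g ∈ Matrix.unitaryGroup (Fin N) ℂ) {δ : ℝ} (hδ : 0 ≤ δ) :
    Measure.pi (fun _ : {e : Edge 4 L // e ∉ combEdges L} => haarProbability G)
        (Set.pi Set.univ fun _ => {g : G | ‖ρ g - 1‖ ≤ δ}) ≤
      Measure.pi (fun _ : Edge 4 L => haarProbability G)
        {U : GaugeConfig 4 L G | wilsonAction ρ U ≤ 8 * δ ^ 2 * Fintype.card (Plaquette 4 L)} := by
  have hBm : MeasurableSet
      (Set.pi Set.univ fun _ : {e : Edge 4 L // e ∉ combEdges L} => {g : G | ‖ρ g - 1‖ ≤ δ}) :=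
    MeasurableSet.univ_pi fun _ => measurableSet_gball ρ hρ δ
  rw [← map_combSection_pi_haar, Measure.map_apply measurable_combSection hBm]
  refine measure_mono fun U hW => ?_
  have hW' : (fun e : {e : Edge 4 L // e ∉ combEdges L} =>
      combHolonomy U e.1.1 * U e.1 * (combHolonomy U (e.1.1.shift e.1.2))⁻¹) ∈
        Set.pi Set.univ (fun _ : {e : Edge 4 L // e ∉ combEdges L} => {g : G | ‖ρ g - 1‖ ≤ δ}) := hW
  refine wilsonAction_le_of_comb_ball ρ hU hδ fun e he => ?_
  have h' : combHolonomy U e.1 * U e * (combHolonomy U (e.1.shift e.2))⁻¹ ∈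
      {g : G | ‖ρ g - 1‖ ≤ δ} := (Set.mem_univ_pi.1 hW') ⟨e, he⟩
  exact h'

/-- **Gauge-fixed Gaussian lower bound, master form**: with the small-ball constant `C₁` of `r`
(`exists_haar_gball_ge`), for all `L`, `β ≥ 0` and `0 < δ ≤ 1`,
`e^{−β · 8 δ² #P} (C₁ δ^D)^{3L⁴+1} ≤ Z_L(β)` — the Laplace bound
`exp_mul_measureReal_le_integral_exp` on the sublevel set `{S ≤ 8 δ² #P}`, which carries at least
the product-Haar mass `Haar{‖r g − 1‖ ≤ δ}^{3L⁴+1} ≥ (C₁ δ^D)^{3L⁴+1}` of the off-comb product ball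
(`pi_offComb_ball_le_pi_wilsonAction_le`, `pi_offComb_ball_eq`). -/
theorem exp_mul_pow_le_partitionFunction_toReal_comb (r : LatticeRep G) :
    ∃ C₁ : ℝ, 0 < C₁ ∧ ∀ (L : ℕ) [NeZero L] (β δ : ℝ), 0 ≤ β → 0 < δ → δ ≤ 1 →
      Real.exp (-(β * (8 * δ ^ 2 * Fintype.card (Plaquette 4 L)))) *
          (C₁ * δ ^ dimE r.ρ) ^ (3 * L ^ 4 + 1) ≤
        (partitionFunction (d := 4) (L := L) r.ρ β).toReal := by
  obtain ⟨C₁, hC₁, hball⟩ := exists_haar_gball_ge r.ρ r.continuous r.injective r.mem_unitary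
  refine ⟨C₁, hC₁, fun L _ β δ hβ hδ hδ1 => ?_⟩
  have h1 : C₁ * δ ^ dimE r.ρ ≤ (haarProbability G {g : G | ‖r.ρ g - 1‖ ≤ δ}).toReal :=
    (ENNReal.ofReal_le_iff_le_toReal (measure_ne_top _ _)).1 (hball δ hδ hδ1)
  have h2 : (C₁ * δ ^ dimE r.ρ) ^ (3 * L ^ 4 + 1) ≤
      (Measure.pi fun _ : Edge 4 L => haarProbability G).real
        {U : GaugeConfig 4 L G |
          wilsonAction r.ρ U ≤ 8 * δ ^ 2 * Fintype.card (Plaquette 4 L)} := by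
    rw [measureReal_def]
    calc (C₁ * δ ^ dimE r.ρ) ^ (3 * L ^ 4 + 1)
        ≤ (haarProbability G {g : G | ‖r.ρ g - 1‖ ≤ δ}).toReal ^ (3 * L ^ 4 + 1) :=
          pow_le_pow_left₀ (by positivity) h1 _
      _ = (Measure.pi (fun _ : {e : Edge 4 L // e ∉ combEdges L} => haarProbability G)
            (Set.pi Set.univ fun _ => {g : G | ‖r.ρ g - 1‖ ≤ δ})).toReal := by
          rw [pi_offComb_ball_eq, ENNReal.toReal_pow]
      _ ≤ ((Measure.pi fun _ : Edge 4 L => haarProbability G)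
            {U : GaugeConfig 4 L G |
              wilsonAction r.ρ U ≤ 8 * δ ^ 2 * Fintype.card (Plaquette 4 L)}).toReal :=
          ENNReal.toReal_mono (measure_ne_top _ _)
            (pi_offComb_ball_le_pi_wilsonAction_le r.ρ r.continuous r.mem_unitary hδ.le)
  rw [partitionFunction_toReal_eq_integral r.ρ r.continuous β]
  calc Real.exp (-(β * (8 * δ ^ 2 * Fintype.card (Plaquette 4 L)))) *
        (C₁ * δ ^ dimE r.ρ) ^ (3 * L ^ 4 + 1)
      ≤ Real.exp (-β * (8 * δ ^ 2 * Fintype.card (Plaquette 4 L))) *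
          (Measure.pi fun _ : Edge 4 L => haarProbability G).real
            {U : GaugeConfig 4 L G |
              wilsonAction r.ρ U ≤ 8 * δ ^ 2 * Fintype.card (Plaquette 4 L)} := by
        rw [neg_mul]
        exact mul_le_mul_of_nonneg_left h2 (Real.exp_pos _).le
    _ ≤ ∫ U, Real.exp (-β * wilsonAction r.ρ U) ∂(Measure.pi fun _ : Edge 4 L => haarProbability G) :=
        exp_mul_measureReal_le_integral_exp r.ρ r.continuous hβ _

end Measure

/-- **Gauge-fixed Gaussian lower bound for the torus partition function** (registered wave-4 stub,
verbatim): there are `C₁ > 0` (the small-ball constant of `r`) and `A` (`= 48`) such that for every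
torus `(ℤ/L)⁴` and every `β ≥ 1`, `e^{−A L⁴} (C₁ β^{−D/2})^{3L⁴+1} ≤ Z_L(β)`, `D = dimE r.ρ` — the master
form `exp_mul_pow_le_partitionFunction_toReal_comb` at the Gaussian scale `δ = β^{−1/2}`
(`β · 8 β⁻¹ · 6L⁴ = 48 L⁴`, `(β^{−1/2})^D = β^{−D/2}`). -/
theorem torusPartitionFunction_lower :
    ∀ {G : Type} [Group G] [TopologicalSpace G] [IsTopologicalGroup G] [CompactSpace G]
      [MeasurableSpace G] [BorelSpace G] [SecondCountableTopology G] (r : LatticeRep G),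
      ∃ C₁ A : ℝ, 0 < C₁ ∧ ∀ (L : ℕ) [NeZero L] (β : ℝ), 1 ≤ β →
        Real.exp (-(A * (L : ℝ) ^ 4)) *
            (C₁ * β ^ (-((dimE r.ρ : ℝ) / 2))) ^ (3 * L ^ 4 + 1) ≤
          (partitionFunction (d := 4) (L := L) r.ρ β).toReal := by
  intro G _ _ _ _ _ _ _ r
  obtain ⟨C₁, hC₁, h⟩ := exp_mul_pow_le_partitionFunction_toReal_comb r
  refine ⟨C₁, 48, hC₁, fun L _ β hβ => ?_⟩
  have hβ0 : 0 < β := by linarith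
  -- the Gaussian scale `δ = β^{-1/2}`
  have hδ0 : 0 < β ^ (-(1 / 2 : ℝ)) := Real.rpow_pos_of_pos hβ0 _
  have hδ1 : β ^ (-(1 / 2 : ℝ)) ≤ 1 := Real.rpow_le_one_of_one_le_of_nonpos hβ (by norm_num)
  have hδD : (β ^ (-(1 / 2 : ℝ))) ^ dimE r.ρ = β ^ (-((dimE r.ρ : ℝ) / 2)) := by
    rw [← Real.rpow_natCast, ← Real.rpow_mul hβ0.le]
    congr 1
    ring
  have hδ2 : (β ^ (-(1 / 2 : ℝ))) ^ 2 = β⁻¹ := by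
    rw [← Real.rpow_natCast, ← Real.rpow_mul hβ0.le, ← Real.rpow_neg_one]
    norm_num
  have hmain := h L β (β ^ (-(1 / 2 : ℝ))) hβ0.le hδ0 hδ1
  rw [hδD, hδ2, card_plaquette] at hmain
  refine le_trans (le_of_eq ?_) hmain
  congr 2
  -- `β · 8 β⁻¹ · 6 L⁴ = 48 L⁴`
  field_simp
  push_cast
  ring

end Summit.QuantumFields.YangMills.Theorems.FemtoCurvatureTwoPointC.TorusGauge

end
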